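import Literature.Computability.Complexity.TruthTableClosure
import Literature.Computability.Complexity.NondeterministicProofs
import HarnessLib

/-!
# Time-bounded truth-table autoreducibility with budgets charged to the input length

Toolkit continuing `TruthTableClosure.lean` (the truth-table scheme `Q`, `q`, `D`: the `i`-th
query on input `x` is `Q ⟨x, 1ⁱ⟩` for `i < q(|x|)`, the answer bits are `ttBits Q A x (q |x|)`,
and `x` is accepted iff `⟨x, answer bits⟩ ∈ D`; `⟨·,·⟩ = boolPair`).

An **autoreduction** of a set `A` is a reduction of `A` to itself that never queries its own
input (Buhrman–Fortnow–van Melkebeek–Torenvliet 2000, Def. 2.1); it is *nonadaptive*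
(truth-table) when the list of queries is computed from the input alone, and a `q(n)-tt`
reduction asks at most `q(n)` queries on inputs of length `n` (ibid., §2). When diagonalizing
against nonadaptive autoreductions BFvMT measure them by their running time `τ(n)` and by the
length of their queries (ibid., §3.2: "a nonadaptive autoreduction running in time `τ(n)`";
"reductions with polynomially bounded query lengths"). Making these two resources explicit
parameters gives the notion of this file:

* `IsTimedTTAutoreducible T ℓ A` — `A` is **`(T, ℓ)`-tt-autoreducible**: there are a query
  generator `Q`, a query-count function `q`, an evaluator `D` and a constant `c` such that on
  inputs `x` of length `n`: at most `q n ≤ c·T n + c` queries are asked; the `i`-th query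
  `Q ⟨x, 1ⁱ⟩` is produced by a TM2 machine within `c·T n + c` steps (`GeneratesInTime`); the
  verdict `[⟨x, β⟩ ∈ D]` is produced by a TM2 machine within `c·T n + c` steps for every
  candidate answer vector `β ∈ {0,1}^{q n}` (`EvaluatesInTime`); every query has length `≤ ℓ n`
  (reach) and differs from `x` (self-avoidance); and the scheme decides `A` with oracle `A`:
  `A = ttLangFn Q q D A`.

This is the `(t, q)`-tt-autoreducibility of the 2001 programme's note on the route
`exp-truth-table-autoreducibility` (archive `work/tight.tex`, Def. 1.1: "a deterministic oracle
Turing machine that on inputs `x` of length `n` runs in time `t(n)`, computes its list of queries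
from `x` alone, lists only strings of length at most `q(n)` and never `x` itself, and satisfies
`M^A(x) = A(x)`"), written in the query-by-query format of `ttLang`; its wall statement
`W(a, a′)` — every `≤ᵖ_{3-tt}`-complete set for `EXP` decidable in time `2^{n^a}` is
`(2^{n^{a′}}·n^r, n^r)`-tt-autoreducible for some `r` — is typed over the present definition with
`T n = 2^{n^{a′}}·n^r`, `ℓ n = n^r`.

## Why the budgets are charged to `|x|`

The machines generating `Q ⟨x, 1ⁱ⟩` and evaluating `⟨x, β⟩` read inputs of length
`2|x| + 2 + i` resp. `2|x| + 2 + q(|x|)`, which for exponential `T` is exponentially longer than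
`x`. Charging the time to the length of these padded inputs (e.g. asking `Q ∈ FTIME T`,
`D ∈ DTIME T`) trivialises the notion for superpolynomial `T`: with `T n = 2^{n^{a′}}`, a scheme
asking `q(n) = n^{⌈a/a′⌉}` dummy queries hands the evaluator an input of length `N ≥ q(n)`, hence
time `T(N) ≥ 2^{n^a}` — enough to decide any `A ∈ DTIME(2^{n^a})` outright, ignoring the
answers. Hence all budgets below are the functions `c·T(|x|) + c` of the ORIGINAL input length,
in the per-input form `Turing.TM2ComputableAux.OutputsWithin` of `TimeBounds.lean` (the
arithmetic big-O `c·T + c` is that of `DTIME`, `FTIME` in `Classes.lean`).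

## Design notes

* The query count is a function `q : ℕ → ℕ` bounded by the time (`q n ≤ c·T n + c`: a machine
  running in time `t(n)` lists at most `t(n)` queries), not a polynomial as in `ttLang`: the
  motivating one-round autoreductions in time `2^{n^{a′}}·n^{O(1)}` (enumerate the `2^{n^{a′}}`
  seeds of a probabilistic autoreduction and take the majority vote) ask exponentially many
  queries. `ttLangFn` is `ttLang` with such a count; `ttLangFn_eq_ttLang` identifies the two on
  polynomial counts.
* Per-query versus whole-list time. Def. 1.1 of the note bounds the TOTAL time `t(n)` of a
  machine writing the whole query list; here each of the `q(n) ≤ c·T(n) + c` queries is generated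
  within `c·T(n) + c` steps from its index, as the route's planner requested (format of
  `ttLang`). A whole-list machine of time `t` gives per-query generation and evaluation in time
  `O(t(n))` (rerun it and read off the `i`-th entry, resp. replay it on the given answers), and
  per-query budgets `T` give a whole-list machine of time `O((T(n) + 1)^2)`; for the families
  `T n = 2^{n^{a′}}·n^r` quantified as "some `a′ < a`, some `r`" of `W(a, a′)` the two readings
  therefore agree (`2^{2n^{a′}} ≤ 2^{n^{a″}}` eventually, for any `a′ < a″ < a`).
* Time bounds are imposed only on the inputs the scheme uses (`⟨x, 1ⁱ⟩` with `i < q(|x|)`;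
  `⟨x, β⟩` with `|β| = q(|x|)`, for EVERY `β`, i.e. for every oracle, as for truth-table
  reductions in Ladner–Lynch–Selman 1975, §3); `Q` and `D` are total but unconstrained
  elsewhere, which does not affect `ttLangFn Q q D A`.
* Machines are Mathlib's bundled `Turing.TM2ComputableAux Bool Bool` with the identity coding of
  bit strings and `Computability.encodeBool` for verdicts, exactly as in `TimeClass`/`DTIME`.

API: `mem_ttLangFn_iff`, `ttLangFn_eq_ttLang`; monotonicity in both budgets
(`IsTimedTTAutoreducible.mono`); and the trivial autoreduction "decide, ask nothing":
`IsTimedTTAutoreducible.of_mem_DTIME` — every `A ∈ DTIME T` (`T n ≥ n`) is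
`(T, ℓ)`-tt-autoreducible with `q = 0` queries (note, remark after Def. 1.1), which in particular
shows the definition is inhabited. NOT here: the polynomial-time notion `≤ᵖ_tt`-autoreducible of
BFvMT Def. 2.1 itself (filed separately over `ttLang`, `FP`, `P`), adaptive (Turing)
autoreductions, probabilistic and nonuniform variants.

## References

* H. Buhrman, L. Fortnow, D. van Melkebeek, L. Torenvliet, *Separating complexity classes using
  autoreducibility*, SIAM J. Comput. 29(5) (2000) 1497–1520, Def. 2.1 (autoreduction), §2
  (`q(n)-tt` reductions), §3.2 (nonadaptive autoreductions of running time `τ(n)`; polynomially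
  bounded query lengths). [BuhrmanEtAl2000]
* H. Buhrman, L. Torenvliet, *A Post's program for complexity theory*, Bull. EATCS 85 (2005)
  41–51, §2. [BuhrmanTorenvliet2005]
* R. E. Ladner, N. A. Lynch, A. L. Selman, *A comparison of polynomial time reducibilities*,
  Theoret. Comput. Sci. 1 (1975) 103–123, §3 (`≤ᵖₜₜ`). [LadnerLynchSelman1975]
* Programme 2001, route `pnp/exp-truth-table-autoreducibility`, note `work/tight.tex`
  (unrefereed), Def. 1.1 (`(t,q)`-tt-autoreducible, `W(a,a′)`) and the remark following it;
  `work/WALL-REQUEST-5.md` (statement W).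
-/

namespace Literature.Computability.Complexity

open _root_.Computability Polynomial Turing

/-! ### Truth-table schemes with an arbitrary query count -/

section TTFn

variable (Q : List Bool → List Bool) (q : ℕ → ℕ) (D : Language Bool)

/-- **The language truth-table reduced to `A` with `q(n)` queries**, for an arbitrary query-count
function `q : ℕ → ℕ`: `x` is a member iff `⟨x, b₀ ⋯ b_{q(|x|)-1}⟩ ∈ D` where
`bᵢ = [Q ⟨x, 1ⁱ⟩ ∈ A]` (`ttBits`). This is `ttLang` (`TruthTableClosure.lean`) with the
polynomial count replaced by a function (`ttLangFn_eq_ttLang`), as needed for `q(n)-tt`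
reductions with superpolynomially many queries. [Buhrman–Fortnow–van Melkebeek–Torenvliet 2000,
§2 (`q(n)-tt` reductions); Ladner–Lynch–Selman 1975, §3] [cite: BuhrmanEtAl2000, §2] -/
def ttLangFn (A : Language Bool) : Language Bool :=
  {x | boolPair x (ttBits Q A x (q x.length)) ∈ D}

variable {Q q D}

/-- Unfolding lemma for `ttLangFn`. [cite: BuhrmanEtAl2000, §2] -/
theorem mem_ttLangFn_iff {A : Language Bool} {x : List Bool} :
    x ∈ ttLangFn Q q D A ↔ boolPair x (ttBits Q A x (q x.length)) ∈ D :=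
  Iff.rfl

/-- On a polynomial query count `ttLangFn` is `ttLang` (definitionally). [folklore] -/
theorem ttLangFn_eq_ttLang (Q : List Bool → List Bool) (p : Polynomial ℕ) (D A : Language Bool) :
    ttLangFn Q (fun n => p.eval n) D A = ttLang Q p D A :=
  rfl

end TTFn

/-! ### Per-input time budgets for the two halves of a truth-table scheme -/

section Timed

/-- `GeneratesInTime Q q t M`: the TM2 machine `M` **generates the queries of the scheme
`(Q, q)` within the budget `t` charged to `|x|`**: for every `x` and every query index
`i < q(|x|)`, started on `⟨x, 1ⁱ⟩` it halts with output `Q ⟨x, 1ⁱ⟩` within `t(|x|)` steps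
(identity coding of bit strings, as in `TimeClass`). Nothing is required on other inputs.
[Buhrman–Fortnow–van Melkebeek–Torenvliet 2000, §3.2 (nonadaptive autoreductions running in
time `τ(n)`)] [cite: BuhrmanEtAl2000, §3.2] -/
def GeneratesInTime (Q : List Bool → List Bool) (q t : ℕ → ℕ) (M : TM2ComputableAux Bool Bool) :
    Prop :=
  ∀ x : List Bool, ∀ i < q x.length,
    M.OutputsWithin (boolPair x (List.replicate i true)) (Q (boolPair x (List.replicate i true)))
      (t x.length)

/-- `EvaluatesInTime D q t M`: the TM2 machine `M` **evaluates the truth table within the budget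
`t` charged to `|x|`**: for every `x` and every candidate answer vector `β` of length `q(|x|)`
(i.e. for every oracle), started on `⟨x, β⟩` it halts with the verdict `[⟨x, β⟩ ∈ D]` (coded by
`encodeBool`) within `t(|x|)` steps. Nothing is required on other inputs.
[Buhrman–Fortnow–van Melkebeek–Torenvliet 2000, §3.2; Ladner–Lynch–Selman 1975, §3 (the
tt-condition evaluator)] [cite: BuhrmanEtAl2000, §3.2] -/
noncomputable def EvaluatesInTime (D : Language Bool) (q t : ℕ → ℕ) (M : TM2ComputableAux Bool Bool) :
    Prop :=
  ∀ x β : List Bool, β.length = q x.length →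
    M.OutputsWithin (boolPair x β) (encodeBool (D.boolIndicator (boolPair x β))) (t x.length)

variable {Q : List Bool → List Bool} {D : Language Bool} {q t t' : ℕ → ℕ}
  {M : TM2ComputableAux Bool Bool}

/-- Monotonicity of `GeneratesInTime` in the budget. [folklore] -/
theorem GeneratesInTime.mono (h : GeneratesInTime Q q t M) (ht : ∀ n, t n ≤ t' n) :
    GeneratesInTime Q q t' M :=
  fun x i hi => (h x i hi).mono (ht _)

/-- Monotonicity of `EvaluatesInTime` in the budget. [folklore] -/
theorem EvaluatesInTime.mono (h : EvaluatesInTime D q t M) (ht : ∀ n, t n ≤ t' n) :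
    EvaluatesInTime D q t' M :=
  fun x β hβ => (h x β hβ).mono (ht _)

end Timed

/-! ### The notion -/

/-- **`(T, ℓ)`-tt-autoreducibility (time-bounded one-round autoreducibility, budgets charged to
the input length).** `IsTimedTTAutoreducible T ℓ A` says: there are a query generator
`Q : {0,1}* → {0,1}*`, a query-count function `q : ℕ → ℕ`, an evaluator `D ⊆ {0,1}*` and a
constant `c` such that, writing `n = |x|`,

* (count) `q n ≤ c·T n + c`;
* (generation, timed) some TM2 machine outputs the `i`-th query `Q ⟨x, 1ⁱ⟩` on input `⟨x, 1ⁱ⟩`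
  within `c·T n + c` steps, for every `x` and `i < q n` (`GeneratesInTime`);
* (evaluation, timed) some TM2 machine outputs the verdict `[⟨x, β⟩ ∈ D]` on input `⟨x, β⟩`
  within `c·T n + c` steps, for every `x` and every `β ∈ {0,1}^{q n}` (`EvaluatesInTime`);
* (reach) `|Q ⟨x, 1ⁱ⟩| ≤ ℓ n` for all `i < q n`;
* (self-avoidance) `Q ⟨x, 1ⁱ⟩ ≠ x` for all `i < q n` — the machine never queries its own input;
* (correctness) `x ∈ A ↔ ⟨x, [Q⟨x,1⁰⟩ ∈ A] ⋯ [Q⟨x,1^{q n-1}⟩ ∈ A]⟩ ∈ D`, i.e. `A = ttLangFn Q q D A`.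

Informally: `A` is decided, with `A` itself as oracle, by a deterministic machine that on inputs
of length `n` runs in time `O(T(n))` (per query and for the final evaluation), computes its
queries before any oracle access (one nonadaptive round), queries only strings of length
`≤ ℓ(n)`, and never queries its own input — an autoreduction in the sense of
Buhrman–Fortnow–van Melkebeek–Torenvliet 2000, Def. 2.1, nonadaptive, with the running time
`τ(n)` and the query length of ibid. §3.2 as explicit parameters (the `(t,q)`-tt-autoreducibility
of the 2001 programme note `tight.tex`, Def. 1.1, in the query-by-query format of `ttLang`; see
the module docstring for why the budgets are functions of `|x|` and not of the padded inputs,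
and for per-query versus whole-list time). `≤ᵖ_tt`-autoreducible corresponds to polynomial `T`
and `ℓ`; the wall statement `W(a, a′)` uses `T n = 2^{n^{a′}}·n^r`, `ℓ n = n^r`.
[Buhrman–Fortnow–van Melkebeek–Torenvliet 2000, Def. 2.1, §2, §3.2]
[cite: BuhrmanEtAl2000, Def. 2.1 and §3.2] -/
def IsTimedTTAutoreducible (T ℓ : ℕ → ℕ) (A : Language Bool) : Prop :=
  ∃ (Q : List Bool → List Bool) (q : ℕ → ℕ) (D : Language Bool) (c : ℕ),
    (∀ n, q n ≤ c * T n + c) ∧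
    (∃ M : TM2ComputableAux Bool Bool, GeneratesInTime Q q (fun n => c * T n + c) M) ∧
    (∃ M : TM2ComputableAux Bool Bool, EvaluatesInTime D q (fun n => c * T n + c) M) ∧
    (∀ x : List Bool, ∀ i < q x.length,
      (Q (boolPair x (List.replicate i true))).length ≤ ℓ x.length) ∧
    (∀ x : List Bool, ∀ i < q x.length, Q (boolPair x (List.replicate i true)) ≠ x) ∧
    A = ttLangFn Q q D A

/-! ### API -/

/-- **Monotonicity in both budgets**: a `(T, ℓ)`-tt-autoreduction is a `(T′, ℓ′)`-tt-autoreduction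
whenever `T ≤ T′` and `ℓ ≤ ℓ′` pointwise (same scheme, same constant; "W(a,a′) becomes weaker
as `a′` increases"). [2001 programme note `tight.tex`, Def. 1.1 (remark)] [folklore] -/
theorem IsTimedTTAutoreducible.mono {T T' ℓ ℓ' : ℕ → ℕ} {A : Language Bool}
    (h : IsTimedTTAutoreducible T ℓ A) (hT : ∀ n, T n ≤ T' n) (hℓ : ∀ n, ℓ n ≤ ℓ' n) :
    IsTimedTTAutoreducible T' ℓ' A := by
  obtain ⟨Q, q, D, c, hq, ⟨MQ, hMQ⟩, ⟨MD, hMD⟩, hlen, hself, hA⟩ := h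
  have hc : ∀ n, c * T n + c ≤ c * T' n + c := fun n =>
    Nat.add_le_add_right (Nat.mul_le_mul_left c (hT n)) c
  exact ⟨Q, q, D, c, fun n => (hq n).trans (hc n), ⟨MQ, hMQ.mono hc⟩, ⟨MD, hMD.mono hc⟩,
    fun x i hi => (hlen x i hi).trans (hℓ _), hself, hA⟩

/-- The correctness clause pointwise: under a `(T, ℓ)`-tt-autoreduction `(Q, q, D)`,
`x ∈ A ↔ ⟨x, answer bits⟩ ∈ D`. [folklore] -/
theorem mem_iff_of_eq_ttLangFn {Q : List Bool → List Bool} {q : ℕ → ℕ} {D A : Language Bool}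
    (hA : A = ttLangFn Q q D A) (x : List Bool) :
    x ∈ A ↔ boolPair x (ttBits Q A x (q x.length)) ∈ D := by
  conv_lhs => rw [hA]
  rfl

/-- **Decide, ask nothing**: every `A ∈ DTIME T` with `T n ≥ n` is `(T, ℓ)`-tt-autoreducible for
every reach `ℓ`, by the scheme with `q = 0` queries whose evaluator decides `A` on the first
component of `⟨x, ε⟩` (the machine `boolUnpairFstLift` of a `DTIME T` decider: time
`c·T n + c + (2n + 5) ≤ (c+5)·T n + (c+5)`). In particular the notion is inhabited, and
`W(a, a′)` is trivial for `a′ ≥ a`. [2001 programme note `tight.tex`, remark after Def. 1.1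
("trivially every `A ∈ DTIME(2^{n^a})` is `(2^{n^a}, 0)`-tt-autoreducible (decide, ask
nothing)")] [folklore] -/
theorem IsTimedTTAutoreducible.of_mem_DTIME {T : ℕ → ℕ} (hT : ∀ n, n ≤ T n) {A : Language Bool}
    (hA : A ∈ DTIME T) (ℓ : ℕ → ℕ) : IsTimedTTAutoreducible T ℓ A := by
  obtain ⟨c, M, hM⟩ := hA
  refine ⟨id, fun _ => 0, {w | (boolUnpair w).1 ∈ A}, c + 5, fun n => Nat.zero_le _,
    ⟨M, fun x i hi => absurd hi (Nat.not_lt_zero i)⟩, ⟨boolUnpairFstLift M, fun x β hβ => ?_⟩,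
    fun x i hi => absurd hi (Nat.not_lt_zero i), fun x i hi => absurd hi (Nat.not_lt_zero i), ?_⟩
  · -- the evaluator: no answer bits, run the decider of `A` on the first component
    obtain rfl : β = [] := List.eq_nil_of_length_eq_zero hβ
    have h := outputsWithin_boolUnpairFstLift M (hM (boolUnpair (boolPair x [])).1)
    refine h.mono ?_
    simp only [id, boolUnpair_boolPair, length_boolPair, List.length_nil]
    have hx := hT x.length
    nlinarith [hx, Nat.zero_le (c * T x.length)]
  · -- correctness: `x ∈ A ↔ (boolUnpair ⟨x, ε⟩).1 ∈ A`
    ext x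
    change x ∈ A ↔ (boolUnpair (boolPair x (ttBits id A x 0))).1 ∈ A
    simp [ttBits]

end Literature.Computability.Complexity
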